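import Literature.MathematicalPhysics.QuantumFieldTheory.Balaban1983to89.B12NearTerms321
import Literature.MathematicalPhysics.QuantumFieldTheory.Balaban1983to89.B12CauchyRemainder354

/-!
# `Balaban1983to89.B12Sect3Closing281` — T. Bałaban, *Renormalization group approach to lattice gauge field theories. I.
Generation of effective actions in a small field approximation and a coupling constant renormalization in four dimensions*,
Commun. Math. Phys. **109** (1987) 249–301, doi:10.1007/bf01215223 [Balaban1987RG1]: **the closing claim of Sect. 3,
p. 281 [PDF 33] — «the remaining terms are irrelevant» — ASSEMBLED from the section's own bounds into the shape (0.29)**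

HONEST FRAMING (cell `lit-balaban`, verbatim): statement-level skeleton of published theorems with citation tags; proofs where landed; nothing here is a claim about the Yang–Mills mass gap.

PDF held: `paper:balaban1987-cmp109-rg-i-small-field` (journal page = PDF page + 248); pp. 258, 270–274, 277, 280–281
re-read by this unit from the held text (`p0010`, `p0022`–`p0026`, `p0029`, `p0032`–`p0033`).  SKELETON row of record:
**`B12.Txt@281`** (the only `absent` row of Sect. 3; owner r09), with pointers for the two concrete clauses of the §0
sketch `B12.Txt@258`.  Unit `lit-balaban-type-B12` (R141 (B) literature typer [B12] → node N09), HOME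
`run/shared/lean/pub/lit-balaban/lit-balaban-type-B12/`.

THE PRINT, verbatim.  p. 281 [PDF 33]: *«The considerations of this section gave a full control over the terms of the
expansion of the difference E_k(U_k(exp iB′V^{(k)})) − E_k(U_k(V^{(k)})), except the terms in the sum on the right-hand
side of (3.34). These terms are connected with the renormalization, and we will analyze them in the next section. The
remaining terms are irrelevant according to our terminology, i.e. they satisfy bounds of the form (0.28) on their domains
of analyticity.»*  (Numbering: §3 calls the irrelevance bound «(0.28)»; as printed in §0 it is **(0.29)** p. 258
*«|𝐕^{(j)}(X, U_k)| ≤ O(1)(Lʲη)^{4+α} exp(−κd_j(X)), α > 0»*, typed `B12.Bound029Printed`; (0.28) is the extraction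
identity — located slip S-B12-281a ∕ DIVERGENCE D-pv03.4, no mathematical content.)  p. 258 [PDF 10], the §0 sketch of
the same: *«If its localization domain X is large … the first exponential can be bounded by an arbitrary positive power of
Lʲη, e.g. by (5!/κ⁵)(Lʲη)⁵. … The fifth order term can be bounded by E₀O((Lʲη)⁵) exp(−κd_j(X)). … The remaining terms
have bounds as above.»*

WHAT «THE REMAINING TERMS» ARE (the architecture of Sect. 3, pp. 270–281, followed verbatim).  The expansion of the
difference is organised by (3.3)–(3.5): for each scale `j` and each `X ∈ 𝐃_j`, either (first condition of (3.5)) `X` is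
LARGE in the ξ-scale — *«d_j(X) > (Lʲη)⁻¹ … the exponential bound (1.18) should give a small factor O((Lʲη)ᴺ)»* (p. 271,
and p. 272 *«the second, simpler case»*) — or `X ⊂ □̃²`, and then the sum over cubes `□` of (3.4) splits into the FAR
cubes (dist^{(ξ)}(X, □) ≥ M(Lʲη)⁻¹: the terms (3.7), bounded through (3.9) and the Cauchy formula (3.15)–(3.17)) and the
near cubes, for which the ζ̃_□-LOCALISATION (3.21)–(3.23) produces remainder terms *«with the small factor O((Lʲη)ᴺ) …
we treat this term in exactly the same way as the terms (3.7)»* (p. 274) and leaves the fundamental expansion (3.34),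
whose terms `n ≤ 4` are EXCLUDED by the sentence itself (they are §4's) and whose FIFTH-ORDER Taylor remainder is
bounded by (3.54) in the form (3.35) *«O(1)exp(−κd_j(X))(O(1)Lʲη)⁵»* (pp. 277, 280).  So the remaining terms are four
families — (R1) large `X`, (R2) far cubes, (R3) localisation remainders, (R4) the fifth-order remainder — and for each
the tree ALREADY holds the printed bound as a theorem: (R1) `B12.largeDomain_bound` ∕ `B12.bound029_of_025_large`
(pv03), (R2) `B12CauchyRemainder354.ineq317_printed` ∕ `ineq317_chain` (3.15)–(3.17) with the (3.9) input `B12Ineq39*`,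
(R3) `B12NearTerms321.smallFactor321` (3.21), (R4) `B12CauchyRemainder354.ineq354_printed` ∕ `remainder334_norm_le_printed`
∕ `ineq335_of_354` (3.54) ⇒ (3.35).  Those modules are imported and used BY NAME; nothing there is restated.

WHAT THIS MODULE PROVES (theorems only; no definition, no `Prop` placeholder, no sorry; axioms standard).  The sentence's
content — each remaining term *«satisfies a bound of the form (0.29)»* — as kernel arithmetic: every one of the four
printed bound SHAPES is put in the (0.29) shape `O(1)·xᴺ·exp(−κ′d_j(X))`, `x = Lʲη > 0`, with the constant `O(1)`, the
power and the rate `κ′` EXPLICIT: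
* §1 `decayFactor_irrelevant` — the mechanism common to (R2)∕(R3): a factor `exp(−(δ₀/2)·M·x⁻¹)` is `≤ (N!/(δ₀M/2)ᴺ)·xᴺ`
  for every `N` (`B12.exp_neg_inv_le_pow`, the printed *«small factor O((Lʲη)ᴺ)»*);
* §2 (R4) `taylorRemainder_irrelevant` ((3.54)-shape + `|B| ≤ C·x` ⇒ `≤ (E₀α₃⁻⁵C⁵)·x⁵·e^{−κd}`: (0.29) with `α = 1`),
  `taylorRemainder_irrelevant_printed` (the same for the LITERAL last term of (3.34) under the hypotheses of
  `remainder334_norm_le_printed`: `f` of class C⁵, holomorphic ray continuation bounded by `E₀e^{−κd}` on discs of radius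
  `α₃/‖B‖` — Lemma 4 + (1.18) by name), `fifthOrder_bound_p258` (p. 258's clause *«E₀O((Lʲη)⁵)exp(−κd_j(X))»* displayed);
* §3 (R2) `farTerm_irrelevant` ((3.17)-shape ⇒ `≤ [E₀·6α₂⁻¹B₀B₃h·N!/(δ₀M/2)ᴺ]·x^{N+1}·e^{−κd}`), `farTerm_irrelevant_printed`
  (from the LITERAL (3.15)–(3.17): the `t_□`-derivative of a function holomorphic on a disc, Cauchy radius `r·m = α₂/3`,
  (3.9)-type input `m ≤ 2s`);
* §4 (R3) `localization_irrelevant` (the `smallFactor321` shape with the Cauchy prefactor ⇒ (0.29) shape);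
* §5 (R1) `largeDomain_irrelevant` (pointer instance of `B12.largeDomain_bound`, `N = 5`: p. 258's «(5!/κ⁵)(Lʲη)⁵» with
  the δ-split of p. 272);
* §6 **`sect3_remaining_irrelevant`** — THE SENTENCE for a whole `𝐃_j`-family: if every term `𝐕(X)` of a family carries
  one of the four printed bounds (with constants uniform in `X`), the family satisfies `B12.Bound029Printed` with
  `α = 1`, rate `(1 − δ)κ` and an explicit `O(1)` (sum of the four constants); `sect3_remaining_irrelevant_pos` records
  `α = 1 > 0` as (0.29) demands.
HONEST SCOPE.  Reshaping arithmetic and Cauchy-estimate bookkeeping ONLY: the input bounds remain the rows B12.Eq3.9 ∕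
Eq3.17 ∕ Eq3.21 (Def@274) ∕ Eq3.35 ∕ Eq3.54 ∕ Eq0.27 and their named theorems; *«on their domains of analyticity»* enters
exactly as the holomorphy hypotheses of the `_printed` forms (Lemma 4 ∕ (3.13)–(3.14) ∕ (3.16) are NOT re-derived); which
concrete terms of Bałaban's expansion fall in which family is the print's bookkeeping (3.3)–(3.5), (3.21)–(3.23), not an
object of this file; the `n ≤ 4` terms of (3.34) are §4's and are excluded by the sentence itself.  Count-neutral.
-/

namespace Literature.MathematicalPhysics.QuantumFieldTheory.Balaban1983to89.B12Sect3Closing281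

open Literature.MathematicalPhysics.QuantumFieldTheory.Balaban1983to89
open Set Metric
open scoped Nat Topology

/-! ## §1. The common mechanism: a decay factor `exp(−(δ₀/2)M(Lʲη)⁻¹)` is `O((Lʲη)ᴺ)` for every `N` -/

/-- p. 271 [PDF 23] ∕ p. 274 [PDF 26], verbatim: *«a small factor O((Lʲη)ᴺ) with an arbitrary power N»* ∕ *«Thus a bound
for the second term above has the small factor O((Lʲη)ᴺ)»* — the arithmetic common to the far cubes (3.17) and the
localisation remainders (3.21): a quantity bounded by `K · x · exp(−(δ₀/2)·M·x⁻¹)` (`x = Lʲη > 0`, `K ≥ 0`) is bounded by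
`K · (N!/((δ₀/2)M)ᴺ) · x^{N+1}` for every `N` (`B12.exp_neg_inv_le_pow`). [cite: Balaban1987RG1, p.271 and (3.21) p.274] -/
theorem decayFactor_irrelevant {T K δ₀ M x : ℝ} (hK : 0 ≤ K) (hδ₀ : 0 < δ₀) (hM : 0 < M) (hx : 0 < x)
    (hT : T ≤ K * x * Real.exp (-((δ₀ / 2 * M) * x⁻¹))) (N : ℕ) :
    T ≤ K * ((N ! : ℝ) / (δ₀ / 2 * M) ^ N) * x ^ (N + 1) := by
  have hc : 0 < δ₀ / 2 * M := by positivity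
  have hpow : Real.exp (-((δ₀ / 2 * M) * x⁻¹)) ≤ (N ! : ℝ) / (δ₀ / 2 * M) ^ N * x ^ N :=
    B12.exp_neg_inv_le_pow hc hx N
  have hKx : 0 ≤ K * x := mul_nonneg hK hx.le
  calc T ≤ K * x * Real.exp (-((δ₀ / 2 * M) * x⁻¹)) := hT
    _ ≤ K * x * ((N ! : ℝ) / (δ₀ / 2 * M) ^ N * x ^ N) := mul_le_mul_of_nonneg_left hpow hKx
    _ = K * ((N ! : ℝ) / (δ₀ / 2 * M) ^ N) * x ^ (N + 1) := by ring

/-- The printed split exponent of (3.9)∕(3.17), *«exp(−½δ₀dist^{(ξ)}(X, □) − ½δ₀M(Lʲη)⁻¹)»*, dominated by its second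
factor: for `δ₀ ≥ 0` and `dist ≥ 0`, `exp(−(δ₀/2)·dist − (δ₀/2)·(M·x⁻¹)) ≤ exp(−((δ₀/2)M)·x⁻¹)`.
[cite: Balaban1987RG1, (3.9) p.271 and (3.17) p.273] -/
theorem exp_split_le {δ₀ dist M x : ℝ} (hδ₀ : 0 ≤ δ₀) (hdist : 0 ≤ dist) :
    Real.exp (-(δ₀ / 2) * dist - (δ₀ / 2) * (M * x⁻¹)) ≤ Real.exp (-((δ₀ / 2 * M) * x⁻¹)) := by
  apply Real.exp_le_exp.mpr
  have h : 0 ≤ (δ₀ / 2) * dist := by positivity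
  linarith

/-- The rate bookkeeping of p. 272 [PDF 24] (*«The remaining factor exp(−(1−δ)κd_j(X))»*): for `δ, κ, d ≥ 0`,
`exp(−κd) ≤ exp(−(1−δ)κd)`. [cite: Balaban1987RG1, p.272] -/
theorem exp_rate_mono {κ δ d : ℝ} (hκ : 0 ≤ κ) (hδ : 0 ≤ δ) (hd : 0 ≤ d) :
    Real.exp (-κ * d) ≤ Real.exp (-((1 - δ) * κ) * d) := by
  apply Real.exp_le_exp.mpr
  have h : 0 ≤ δ * κ * d := by positivity
  nlinarith

/-! ## §2. (R4) The fifth-order remainder of (3.34): (3.54) ⇒ (3.35) ⇒ the (0.29) shape with `α = 1` -/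

/-- **(R4), shape level.**  p. 277 [PDF 29] (3.35) *«O(1)exp(−κd_j(X))(O(1)Lʲη)⁵»* and p. 280 [PDF 32] *«Because |B| <
O(1)Lʲη, e.g. |B| < α₁Lʲη, hence we have the required bound»*: a quantity obeying the right member of (3.54),
`R ≤ E₀α₃⁻⁵|B|⁵exp(−κd_j(X))`, with `|B| ≤ C·x` (`x = Lʲη`) obeys the (0.29)-shape bound
`R ≤ (E₀α₃⁻⁵C⁵) · x^{4+1} · exp(−κd_j(X))` — exponent `4 + α` with `α = 1`. [cite: Balaban1987RG1, (3.35) p.277, (3.54) p.280, p.281] -/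
theorem taylorRemainder_irrelevant {R E₀ α₃ nB κ d C x : ℝ} (hE₀ : 0 ≤ E₀) (hα₃ : 0 < α₃) (hnB : 0 ≤ nB)
    (h354 : R ≤ E₀ * α₃⁻¹ ^ 5 * nB ^ 5 * Real.exp (-(κ * d))) (hB : nB ≤ C * x) :
    R ≤ (E₀ * α₃⁻¹ ^ 5 * C ^ 5) * x ^ (4 + 1) * Real.exp (-κ * d) := by
  have h := B12CauchyRemainder354.ineq335_of_354 hE₀ hα₃ hnB h354 hB
  have hexp : Real.exp (-κ * d) = Real.exp (-(κ * d)) := by rw [neg_mul]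
  rw [hexp]
  calc R ≤ (E₀ * α₃⁻¹ ^ 5) * Real.exp (-(κ * d)) * (C * x) ^ 5 := h
    _ = (E₀ * α₃⁻¹ ^ 5 * C ^ 5) * x ^ (4 + 1) * Real.exp (-(κ * d)) := by ring

/-- p. 258 [PDF 10], verbatim: *«The fifth order term can be bounded by E₀O((Lʲη)⁵) exp(−κd_j(X)).»* — the same bound
displayed with `E₀` in front: `R ≤ E₀ · (α₃⁻⁵C⁵·(Lʲη)⁵) · exp(−κd_j(X))`, the O((Lʲη)⁵) being `α₃⁻⁵C⁵(Lʲη)⁵`.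
[cite: Balaban1987RG1, p.258 and (3.54) p.280] -/
theorem fifthOrder_bound_p258 {R E₀ α₃ nB κ d C x : ℝ} (hE₀ : 0 ≤ E₀) (hα₃ : 0 < α₃) (hnB : 0 ≤ nB)
    (h354 : R ≤ E₀ * α₃⁻¹ ^ 5 * nB ^ 5 * Real.exp (-(κ * d))) (hB : nB ≤ C * x) :
    R ≤ E₀ * (α₃⁻¹ ^ 5 * C ^ 5 * x ^ 5) * Real.exp (-κ * d) := by
  have h := taylorRemainder_irrelevant hE₀ hα₃ hnB h354 hB
  calc R ≤ (E₀ * α₃⁻¹ ^ 5 * C ^ 5) * x ^ (4 + 1) * Real.exp (-κ * d) := h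
    _ = E₀ * (α₃⁻¹ ^ 5 * C ^ 5 * x ^ 5) * Real.exp (-κ * d) := by ring

section Ray

variable {E : Type*} [NormedAddCommGroup E] [NormedSpace ℝ E]
  {F : Type*} [NormedAddCommGroup F] [NormedSpace ℂ F] [CompleteSpace F]

/-- **(R4), literal.**  The LAST TERM OF (3.34) p. 277 — `∫₀¹ dτ ((1 − τ)⁴/4!) ⟨(δ⁵/δB⁵)𝐄^{(j)}(X, U_j(□₀, exp iτB)), ⊗⁵B⟩`
for `f(B) = 𝐄^{(j)}(X, U_j(□₀, exp iB))` of class C⁵ on an open set containing the segment `{τB}` — *«on its domain of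
analyticity»*: the ray function `t ↦ f(tB)` agrees near each `τ ∈ [0, 1]` with a `Φ` holomorphic on the disc of radius
`α₃/‖B‖` about `τ` and bounded there by `E₀exp(−κd_j(X))` (Lemma 4 p. 280 and (1.18), BY NAME as hypotheses, exactly as
in `B12CauchyRemainder354.remainder334_norm_le_printed`) — obeys, when `‖B‖ ≤ C·Lʲη` (p. 280 «e.g. |B| < α₁Lʲη»), the
(0.29)-shape bound `≤ (E₀α₃⁻⁵C⁵)·(Lʲη)^{4+1}·exp(−κd_j(X))`. [cite: Balaban1987RG1, (3.34)–(3.35) p.277, (3.54) p.280, p.281] -/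
theorem taylorRemainder_irrelevant_printed {s : Set E} (hs : IsOpen s) {f : E → F} (hf : ContDiffOn ℝ 5 f s) {B : E}
    (hB0 : B ≠ 0) (hB : ∀ τ ∈ Icc (0 : ℝ) 1, τ • B ∈ s) {Φ : ℂ → F} {α₃ E₀ κ d C x : ℝ} (hα₃ : 0 < α₃)
    (hE₀ : 0 ≤ E₀) (hΦ : ∀ τ ∈ Icc (0 : ℝ) 1, DifferentiableOn ℂ Φ (ball (τ : ℂ) (α₃ / ‖B‖)))
    (hM : ∀ τ ∈ Icc (0 : ℝ) 1, ∀ z ∈ ball (τ : ℂ) (α₃ / ‖B‖), ‖Φ z‖ ≤ E₀ * Real.exp (-(κ * d)))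
    (hagree : ∀ τ ∈ Icc (0 : ℝ) 1, ∀ᶠ t : ℝ in 𝓝 τ, f (t • B) = Φ (t : ℂ)) (hBx : ‖B‖ ≤ C * x) :
    ‖∫ τ in (0 : ℝ)..1, ((1 - τ) ^ 4 / (4 ! : ℝ)) • iteratedFDeriv ℝ 5 f (τ • B) (fun _ => B)‖
      ≤ (E₀ * α₃⁻¹ ^ 5 * C ^ 5) * x ^ (4 + 1) * Real.exp (-κ * d) :=
  taylorRemainder_irrelevant hE₀ hα₃ (norm_nonneg B)
    (B12CauchyRemainder354.remainder334_norm_le_printed hs hf hB0 hB hα₃ hΦ hM hagree) hBx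

end Ray

/-! ## §3. (R2) The far cubes: (3.7) via (3.9), (3.15)–(3.17) ⇒ the (0.29) shape -/

/-- **(R2), shape level.**  p. 273 [PDF 25] (3.17), verbatim: *«|(3.15)| ≦ (1/r)E₀exp(−κd_j(X)) ≦ E₀exp(−κd_j(X)) 6α₂⁻¹
LʲηB₀B₃ × exp(−½δ₀dist^{(ξ)}(X, □) − ½δ₀M(Lʲη)⁻¹)|ζ_□𝐇_k(B′)|»* — a term `D` obeying this right member (`x = Lʲη > 0`,
`h = |ζ_□𝐇_k(B′)| ≥ 0`, `dist = dist^{(ξ)}(X, □) ≥ 0`) obeys, for every `N`, the (0.29)-shape bound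
`D ≤ [E₀·6α₂⁻¹B₀B₃h·N!/((δ₀/2)M)ᴺ] · x^{N+1} · exp(−κd_j(X))` — p. 272 [PDF 24] *«Thus in both cases we have irrelevant
terms»* made quantitative (the first split factor `exp(−½δ₀dist)` is simply dropped, `≤ 1`).
[cite: Balaban1987RG1, (3.17) p.273, p.272, p.281] -/
theorem farTerm_irrelevant {D E₀ κ d α₂ x B₀ B₃ δ₀ M dist h : ℝ} (hE₀ : 0 ≤ E₀) (hα₂ : 0 < α₂) (hx : 0 < x)
    (hB₀ : 0 ≤ B₀) (hB₃ : 0 ≤ B₃) (hδ₀ : 0 < δ₀) (hM : 0 < M) (hdist : 0 ≤ dist) (hh : 0 ≤ h)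
    (h317 : D ≤ E₀ * Real.exp (-(κ * d)) *
      (6 * α₂⁻¹ * (x * B₀ * B₃ * Real.exp (-(δ₀ / 2) * dist - (δ₀ / 2) * (M * x⁻¹)) * h))) (N : ℕ) :
    D ≤ (E₀ * (6 * α₂⁻¹) * B₀ * B₃ * h * ((N ! : ℝ) / (δ₀ / 2 * M) ^ N)) * x ^ (N + 1) * Real.exp (-κ * d) := by
  -- regroup the printed right member as `K · x · (split exponential)` with `K = E₀e^{−κd}·6α₂⁻¹·B₀B₃h`
  set K : ℝ := E₀ * Real.exp (-(κ * d)) * (6 * α₂⁻¹) * B₀ * B₃ * h with hKdef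
  have hK : 0 ≤ K := by rw [hKdef]; positivity
  have h1 : D ≤ K * x * Real.exp (-(δ₀ / 2) * dist - (δ₀ / 2) * (M * x⁻¹)) := by
    calc D ≤ _ := h317
      _ = K * x * Real.exp (-(δ₀ / 2) * dist - (δ₀ / 2) * (M * x⁻¹)) := by rw [hKdef]; ring
  have h2 : D ≤ K * x * Real.exp (-((δ₀ / 2 * M) * x⁻¹)) :=
    h1.trans (mul_le_mul_of_nonneg_left (exp_split_le hδ₀.le hdist) (mul_nonneg hK hx.le))
  have h3 := decayFactor_irrelevant hK hδ₀ hM hx h2 N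
  have hexp : Real.exp (-κ * d) = Real.exp (-(κ * d)) := by rw [neg_mul]
  rw [hexp]
  calc D ≤ K * ((N ! : ℝ) / (δ₀ / 2 * M) ^ N) * x ^ (N + 1) := h3
    _ = (E₀ * (6 * α₂⁻¹) * B₀ * B₃ * h * ((N ! : ℝ) / (δ₀ / 2 * M) ^ N)) * x ^ (N + 1) *
          Real.exp (-(κ * d)) := by rw [hKdef]; ring

section Cauchy

variable {F : Type*} [NormedAddCommGroup F] [NormedSpace ℂ F]

/-- **(R2), literal.**  The far-cube term (3.7) *«on its domain of analyticity»*: its `t_□`-derivative at `t_□ = 0` written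
as the Cauchy integral (3.15) p. 273 — `Φ` (in the paper `t_□ ↦ 𝐄^{(j)}(X, exp iξ[𝐇_j(B(t)) + t_□δ𝐇_j]𝐔)`) holomorphic
on `ball 0 R ⊋ closedBall 0 r`, bounded by `E₀exp(−κd_j(X))` on `|t_□| = r` ((1.18) on the space (3.16)), with the radius
equality `r·m = α₂/3` of (3.15) and the (3.9) input `m ≤ 2s`, `s = LʲηB₀B₃exp(−½δ₀dist^{(ξ)}(X, □) − ½δ₀M(Lʲη)⁻¹)|ζ_□𝐇_k(B′)|`
— all BY NAME as in `B12CauchyRemainder354.ineq317_printed` — obeys, for every `N`, the (0.29)-shape bound of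
`farTerm_irrelevant`. [cite: Balaban1987RG1, (3.15)–(3.17) p.273, (3.9) p.271, p.281] -/
theorem farTerm_irrelevant_printed {Φ : ℂ → F} {r R m E₀ κ d α₂ x B₀ B₃ δ₀ M dist h : ℝ} (hr : 0 < r) (hrR : r < R)
    (hΦ : DifferentiableOn ℂ Φ (ball 0 R)) (hMΦ : ∀ t ∈ sphere (0 : ℂ) r, ‖Φ t‖ ≤ E₀ * Real.exp (-(κ * d)))
    (hE₀ : 0 ≤ E₀) (hm : 0 < m) (hα₂ : 0 < α₂) (hrad : r * m = α₂ / 3)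
    (h39 : m ≤ 2 * (x * B₀ * B₃ * Real.exp (-(δ₀ / 2) * dist - (δ₀ / 2) * (M * x⁻¹)) * h))
    (hx : 0 < x) (hB₀ : 0 ≤ B₀) (hB₃ : 0 ≤ B₃) (hδ₀ : 0 < δ₀) (hM : 0 < M) (hdist : 0 ≤ dist) (hh : 0 ≤ h)
    (N : ℕ) :
    ‖deriv Φ 0‖ ≤ (E₀ * (6 * α₂⁻¹) * B₀ * B₃ * h * ((N ! : ℝ) / (δ₀ / 2 * M) ^ N)) * x ^ (N + 1) *
      Real.exp (-κ * d) := by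
  have hM₀ : 0 ≤ E₀ * Real.exp (-(κ * d)) := by positivity
  have h317 := B12CauchyRemainder354.ineq317_printed hr hrR hΦ hMΦ hM₀ hm hα₂ hrad h39
  exact farTerm_irrelevant hE₀ hα₂ hx hB₀ hB₃ hδ₀ hM hdist hh h317 N

end Cauchy

/-! ## §4. (R3) The ζ̃_□-localisation remainders (3.21)–(3.23) ⇒ the (0.29) shape -/

/-- **(R3).**  p. 274 [PDF 26], verbatim: *«Again, from the exponential decay of the derivative (δ/δB)𝐇_j, and from the
condition dist^{(ξ)}(X, supp(1 − ζ̃_□)) ≥ M(Lʲη)⁻¹, we obtain a bound of the type (3.9) for the expression ⟨…⟩ under the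
exponential. Thus a bound for the second term above has the small factor O((Lʲη)ᴺ), and we treat this term in exactly the
same way as the terms (3.7) before»* (and, after (3.22), *«the term corresponding to the second term in (3.21) has a very
similar form and the same properties»*).  In the shape of `B12NearTerms321.smallFactor321` with the Cauchy prefactor of
(3.17) made explicit: a term `T` with `|T| ≤ E₀exp(−κd_j(X))·A·x·exp(−(δ₀/2)·D)` (`A ≥ 0` the product of the (3.9)∕(3.17)
constants, `x = Lʲη`) and decay distance `D ≥ M·x⁻¹` obeys, for every `N`,
`|T| ≤ [E₀·A·N!/((δ₀/2)M)ᴺ] · x^{N+1} · exp(−κd_j(X))`. [cite: Balaban1987RG1, (3.21)–(3.22) p.274, p.281] -/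
theorem localization_irrelevant {T E₀ κ d A x δ₀ M D : ℝ} (hE₀ : 0 ≤ E₀) (hA : 0 ≤ A) (hx : 0 < x) (hδ₀ : 0 < δ₀)
    (hM : 0 < M) (hT : |T| ≤ E₀ * Real.exp (-(κ * d)) * A * x * Real.exp (-(δ₀ / 2) * D)) (hD : M * x⁻¹ ≤ D)
    (N : ℕ) :
    |T| ≤ (E₀ * A * ((N ! : ℝ) / (δ₀ / 2 * M) ^ N)) * x ^ (N + 1) * Real.exp (-κ * d) := by
  set K : ℝ := E₀ * Real.exp (-(κ * d)) * A with hKdef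
  have hK : 0 ≤ K := by rw [hKdef]; positivity
  have hmono : Real.exp (-(δ₀ / 2) * D) ≤ Real.exp (-((δ₀ / 2 * M) * x⁻¹)) := by
    apply Real.exp_le_exp.mpr
    have : δ₀ / 2 * (M * x⁻¹) ≤ δ₀ / 2 * D := mul_le_mul_of_nonneg_left hD (by positivity)
    nlinarith
  have h1 : |T| ≤ K * x * Real.exp (-((δ₀ / 2 * M) * x⁻¹)) := by
    calc |T| ≤ E₀ * Real.exp (-(κ * d)) * A * x * Real.exp (-(δ₀ / 2) * D) := hT
      _ = K * x * Real.exp (-(δ₀ / 2) * D) := by rw [hKdef]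
      _ ≤ K * x * Real.exp (-((δ₀ / 2 * M) * x⁻¹)) :=
          mul_le_mul_of_nonneg_left hmono (mul_nonneg hK hx.le)
  have h2 := decayFactor_irrelevant hK hδ₀ hM hx h1 N
  have hexp : Real.exp (-κ * d) = Real.exp (-(κ * d)) := by rw [neg_mul]
  rw [hexp]
  calc |T| ≤ K * ((N ! : ℝ) / (δ₀ / 2 * M) ^ N) * x ^ (N + 1) := h2
    _ = (E₀ * A * ((N ! : ℝ) / (δ₀ / 2 * M) ^ N)) * x ^ (N + 1) * Real.exp (-(κ * d)) := by rw [hKdef]; ring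

/-! ## §5. (R1) The large domains (first condition of (3.5)) — pointer instance of `B12.largeDomain_bound` -/

/-- **(R1).**  p. 271 [PDF 23] (3.5) first condition and p. 272 [PDF 24] *«In the second, simpler case, we obtain the
exponential factor exp(−δκ(Lʲη)⁻¹) directly from the bound (1.18) … Thus in both cases we have irrelevant terms»*, with
p. 258's *«e.g. by (5!/κ⁵)(Lʲη)⁵»*: a term with `|E| ≤ E₀exp(−κd_j(X))` on a domain with `d_j(X) ≥ (Lʲη)⁻¹` obeys
`|E| ≤ [E₀·5!/(δκ)⁵] · (Lʲη)^{4+1} · exp(−(1−δ)κd_j(X))` — `B12.largeDomain_bound` at `N = 5`, recorded here so that all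
four families appear with the common exponent `4 + α`, `α = 1`. [cite: Balaban1987RG1, pp.271–272, p.258, p.281] -/
theorem largeDomain_irrelevant {E E₀ κ δ d x : ℝ} (hE : |E| ≤ E₀ * Real.exp (-κ * d)) (hE₀ : 0 ≤ E₀) (hκ : 0 < κ)
    (hδ : 0 < δ) (hx : 0 < x) (hd : x⁻¹ ≤ d) :
    |E| ≤ (E₀ * ((5 ! : ℝ) / (δ * κ) ^ 5)) * x ^ (4 + 1) * Real.exp (-((1 - δ) * κ) * d) :=
  B12.largeDomain_bound (E := E) (d := d) 5 hE hE₀ hκ hδ hx hd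

/-! ## §6. The sentence of p. 281 for a whole `𝐃_j`-family: `B12.Bound029Printed` with `α = 1` -/

/-- **p. 281 [PDF 33], «The remaining terms are irrelevant according to our terminology, i.e. they satisfy bounds of the
form (0.28) [= (0.29)] on their domains of analyticity» — ASSEMBLED for a family.**  Let `𝐕 : 𝐃_j → ℝ` be a family of
remaining terms at scale `j` (`x = Lʲη > 0`), and suppose EVERY `𝐕(X)` carries one of the four printed
bounds of Sect. 3 with constants uniform in `X`:
(R1) `|𝐕(X)| ≤ E₀e^{−κd_j(X)}` with `d_j(X) ≥ x⁻¹` (large domains, (3.5) ∕ p. 272); or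
(R2)∕(R3) `|𝐕(X)| ≤ E₀e^{−κd_j(X)}·6α₂⁻¹·(x·B₀B₃·exp(−½δ₀·dist − ½δ₀·M·x⁻¹)·h)` for some `dist ≥ 0` and `0 ≤ h ≤ H`
((3.17); the localisation remainders of (3.21) *«in exactly the same way as the terms (3.7)»*); or
(R4) `|𝐕(X)| ≤ E₀α₃⁻⁵|B|⁵e^{−κd_j(X)}` for some `0 ≤ |B| ≤ C·x` ((3.54)∕(3.35)).
Then the family satisfies **(0.29)** = `B12.Bound029Printed` with exponent `4 + α`, **`α = 1`**, rate `(1 − δ)κ` (any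
`δ > 0`, p. 272 *«δ is a small, positive number»*; `δ < 1` only keeps the rate positive) and the explicit constant `O(1) = E₀·5!/(δκ)⁵ + E₀·6α₂⁻¹B₀B₃H·4!/((δ₀/2)M)⁴ + E₀α₃⁻⁵C⁵`.
HONEST SCOPE: which of Bałaban's terms carries which bound is the print's bookkeeping (3.3)–(3.5), (3.21)–(3.23) and is
the HYPOTHESIS `hfam`; the bounds themselves are the rows Eq0.27 ∕ Eq3.17 ∕ Eq3.21 ∕ Eq3.54 by name.
[cite: Balaban1987RG1, p.281 with (0.29) p.258] -/
theorem sect3_remaining_irrelevant {S : LocDomainSys} (VX : S.Dom → ℝ) {L η E₀ κ δ α₂ B₀ B₃ δ₀ M H α₃ C : ℝ}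
    {j : ℕ} (hx : 0 < L ^ j * η) (hE₀ : 0 ≤ E₀) (hκ : 0 < κ) (hδ : 0 < δ)
    (hα₂ : 0 < α₂) (hB₀ : 0 ≤ B₀) (hB₃ : 0 ≤ B₃) (hδ₀ : 0 < δ₀) (hM : 0 < M) (hH : 0 ≤ H) (hα₃ : 0 < α₃)
    (hC : 0 ≤ C)
    (hfam : ∀ X,
      (|VX X| ≤ E₀ * Real.exp (-κ * S.dj X) ∧ (L ^ j * η)⁻¹ ≤ S.dj X) ∨
      (∃ dist h : ℝ, 0 ≤ dist ∧ 0 ≤ h ∧ h ≤ H ∧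
        |VX X| ≤ E₀ * Real.exp (-(κ * S.dj X)) * (6 * α₂⁻¹ * ((L ^ j * η) * B₀ * B₃ *
          Real.exp (-(δ₀ / 2) * dist - (δ₀ / 2) * (M * (L ^ j * η)⁻¹)) * h))) ∨
      (∃ nB : ℝ, 0 ≤ nB ∧ nB ≤ C * (L ^ j * η) ∧
        |VX X| ≤ E₀ * α₃⁻¹ ^ 5 * nB ^ 5 * Real.exp (-(κ * S.dj X)))) :
    B12.Bound029Printed VX
      (E₀ * ((5 ! : ℝ) / (δ * κ) ^ 5) + E₀ * (6 * α₂⁻¹) * B₀ * B₃ * H * ((4 ! : ℝ) / (δ₀ / 2 * M) ^ 4) +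
        E₀ * α₃⁻¹ ^ 5 * C ^ 5) L η 1 ((1 - δ) * κ) j := by
  -- abbreviations: the scale unit `x` and the three constants
  set x : ℝ := L ^ j * η with hxdef
  set c₁ : ℝ := E₀ * ((5 ! : ℝ) / (δ * κ) ^ 5) with hc₁
  set c₂ : ℝ := E₀ * (6 * α₂⁻¹) * B₀ * B₃ * H * ((4 ! : ℝ) / (δ₀ / 2 * M) ^ 4) with hc₂
  set c₃ : ℝ := E₀ * α₃⁻¹ ^ 5 * C ^ 5 with hc₃
  have hc₁0 : 0 ≤ c₁ := by rw [hc₁]; positivity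
  have hc₂0 : 0 ≤ c₂ := by rw [hc₂]; positivity
  have hc₃0 : 0 ≤ c₃ := by rw [hc₃]; positivity
  intro X
  have hd : 0 ≤ S.dj X := S.dj_nonneg X
  -- the common target: `c · x⁵ · e^{−(1−δ)κ d}` with `c = c₁ + c₂ + c₃`
  have hpow : x ^ ((4 : ℝ) + 1) = x ^ 5 := by
    rw [show (4 : ℝ) + 1 = ((5 : ℕ) : ℝ) by norm_num, Real.rpow_natCast]
  rw [hpow]
  have hrate : Real.exp (-κ * S.dj X) ≤ Real.exp (-((1 - δ) * κ) * S.dj X) := exp_rate_mono hκ.le hδ.le hd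
  have hx5 : 0 ≤ x ^ 5 := pow_nonneg hx.le 5
  have hexp0 : 0 ≤ Real.exp (-((1 - δ) * κ) * S.dj X) := (Real.exp_pos _).le
  -- each case gives `|VX X| ≤ cᵢ · x⁵ · e^{−(1−δ)κ d}`; then `cᵢ ≤ c₁ + c₂ + c₃`
  have hfinish : ∀ c : ℝ, 0 ≤ c → c ≤ c₁ + c₂ + c₃ →
      |VX X| ≤ c * x ^ 5 * Real.exp (-((1 - δ) * κ) * S.dj X) →
      |VX X| ≤ (c₁ + c₂ + c₃) * x ^ 5 * Real.exp (-((1 - δ) * κ) * S.dj X) := by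
    intro c _ hcle h
    exact h.trans (mul_le_mul_of_nonneg_right (mul_le_mul_of_nonneg_right hcle hx5) hexp0)
  rcases hfam X with ⟨hE, hdX⟩ | ⟨dist, h, hdist, hh, hhH, hb⟩ | ⟨nB, hnB, hnBx, hb⟩
  · -- (R1) large domain: `B12.largeDomain_bound` with N = 5
    have h1 := largeDomain_irrelevant hE hE₀ hκ hδ hx hdX
    refine hfinish c₁ hc₁0 (by linarith) ?_
    simpa [hc₁] using h1
  · -- (R2)/(R3) far cube or localisation remainder: `farTerm_irrelevant` with N = 4, then `h ≤ H` and the rate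
    have h1 := farTerm_irrelevant (D := |VX X|) hE₀ hα₂ hx hB₀ hB₃ hδ₀ hM hdist hh hb 4
    have hcoef : E₀ * (6 * α₂⁻¹) * B₀ * B₃ * h * ((4 ! : ℝ) / (δ₀ / 2 * M) ^ 4) ≤ c₂ := by
      rw [hc₂]
      have hpos : 0 ≤ E₀ * (6 * α₂⁻¹) * B₀ * B₃ := by positivity
      have hfac : 0 ≤ (4 ! : ℝ) / (δ₀ / 2 * M) ^ 4 := by positivity
      have := mul_le_mul_of_nonneg_left hhH hpos
      exact mul_le_mul_of_nonneg_right this hfac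
    have h2 : |VX X| ≤ c₂ * x ^ 5 * Real.exp (-((1 - δ) * κ) * S.dj X) := by
      calc |VX X| ≤ (E₀ * (6 * α₂⁻¹) * B₀ * B₃ * h * ((4 ! : ℝ) / (δ₀ / 2 * M) ^ 4)) * x ^ (4 + 1) *
            Real.exp (-κ * S.dj X) := h1
        _ ≤ c₂ * x ^ 5 * Real.exp (-κ * S.dj X) :=
            mul_le_mul_of_nonneg_right (mul_le_mul_of_nonneg_right hcoef hx5) (Real.exp_pos _).le
        _ ≤ c₂ * x ^ 5 * Real.exp (-((1 - δ) * κ) * S.dj X) :=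
            mul_le_mul_of_nonneg_left hrate (mul_nonneg hc₂0 hx5)
    exact hfinish c₂ hc₂0 (by linarith) h2
  · -- (R4) fifth-order remainder: `taylorRemainder_irrelevant`, then the rate
    have h1 := taylorRemainder_irrelevant (R := |VX X|) hE₀ hα₃ hnB hb hnBx
    have h2 : |VX X| ≤ c₃ * x ^ 5 * Real.exp (-((1 - δ) * κ) * S.dj X) := by
      calc |VX X| ≤ c₃ * x ^ (4 + 1) * Real.exp (-κ * S.dj X) := by simpa [hc₃] using h1
        _ ≤ c₃ * x ^ 5 * Real.exp (-((1 - δ) * κ) * S.dj X) :=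
            mul_le_mul_of_nonneg_left hrate (mul_nonneg hc₃0 hx5)
    exact hfinish c₃ hc₃0 (by linarith) h2

/-- (0.29) demands `α > 0` (p. 258 *«α > 0»*; p. 259 *«Terms satisfying the inequality (0.29) are called irrelevant»*):
the assembled exponent is `4 + α` with `α = 1 > 0`, and the assembled rate `(1 − δ)κ` is positive for `δ < 1` —
bookkeeping for consumers of `sect3_remaining_irrelevant`. [cite: Balaban1987RG1, (0.29) p.258] -/
theorem sect3_remaining_irrelevant_pos {κ δ : ℝ} (hκ : 0 < κ) (hδ1 : δ < 1) :
    (0 : ℝ) < 1 ∧ 0 < (1 - δ) * κ :=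
  ⟨one_pos, mul_pos (by linarith) hκ⟩

end Literature.MathematicalPhysics.QuantumFieldTheory.Balaban1983to89.B12Sect3Closing281
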